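import Summits.ABC.StewartYu.GenThreeInductionOdd
import HarnessLib

/-!
# Cell abc-stewartyu, WP-L.A shell (parcel P-A1): MATVEEV'S INDUCTION ON THE NUMBER OF LOGARITHMS at the
# ARCHIMEDEAN place — the rank-indexed internal statement `CoreArch`, the step data, the per-rank dichotomy,
# the strong induction, the step from the algebraic relation, and the crux text `ArchCoreRat` from the core

`Summits/ABC/StewartYu/GenThreeInductionArch.lean` — cell `abc-stewartyu` (HOME `run/shared/lean/pub/abc-stewartyu/`),
route `YuMatveevShapeRat` (rung A1.L, crux r2 `ArchCoreRat`), seat p4 (g9), parcel WP-L.A P-A1 (induction shell);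
the ARCHIMEDEAN TWIN of `Summits/ABC/StewartYu/GenThreeInductionOdd.lean` (p4-g3) and of p3's Kummer-free
`GenThreeInductionTwoRat` shell — same architecture, same names with `Arch` for `Odd`/`Two`, re-keyed from
`ord_p(∏ θᵢ^{mᵢ} − 1)` to `log |∑ bⱼ log aⱼ|`.  Theorems and three plain `Prop`-valued definitions; no named
fact, no analytic content.

## What this file pins down

Nesterenko's proof of the `cⁿ`-quality archimedean bound (LNM 1819 (2003), Thm 2.2) is an INDUCTION ON THE
NUMBER OF LOGARITHMS via Prop. 2.6: at rank `n` the analytic frame either proves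
`log |Λ| ≥ −C(n)·Ω·log(eB)` (`Λ = ∑ bⱼ log aⱼ`, `Ω = ∏ Aⱼ`) or — through the zero estimate's obstruction
lattice `Φ ∌̸ b` and the lattice lever — produces a new linear form in `r < n` logarithms
`θᵢ = ∏ⱼ aⱼ^{Zᵢⱼ}` with `m₀ b = ∑ mᵢ Zᵢ`, `m₀ ≠ 0`, i.e. `∏ θᵢ^{mᵢ} = (∏ aⱼ^{bⱼ})^{m₀}` and hence
`Λ′ := ∑ mᵢ log θᵢ = m₀ Λ` ((2.9)–(2.10)), together with the cost inequality
`C(r)·∏A′·log(eB′) + log|m₀| ≤ C(n)·∏A·log(eB)` (the last display of the proof of Prop. 2.6).  Since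
`log|Λ| = log|Λ′| − log|m₀|`, the induction hypothesis at rank `r` closes.

The internal statement `CoreArch C r` is the body of the crux text `ArchCoreRat`
(HOME/plan/routeGA-v2/SketchGA.v2.lean; = hypothesis `h₁` of the landed chain theorem
`Summit.ABC.StewartYu.approximationBound_of_shapeCores` and of lp-1's
`Dioph.approximationBound_rat_of_cores`) at the constant FUNCTION `C`: positive rationals `aᵢ`,
multiplicatively independent, weights `h(aᵢ) ≤ Aᵢ`, `1 ≤ Aᵢ` (over `ℚ`, `|log aᵢ| ≤ h(aᵢ)` is automatic,
so print's third weight condition is not a hypothesis), `b ≠ 0`, `|bᵢ| ≤ B`; conclusion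
`−C(r)·∏Aᵢ·log(eB) ≤ log |∑ bᵢ log aᵢ|`.  `StepArch` = the data of one Matveev step in ANALYTIC currency
(comparison `log|Λ′| − D ≤ log|Λ|` for an index cost `D`, and the cost inequality with `+ D`);
`DichotomyArch` = bound-or-step at rank `n`.

Theorems: `core_of_dichotomy` (strong induction on the rank, verbatim from the `p`-adic twins),
`dichotomyArch_of_not_le` (the frame's working form), `cast_prod_zpow` / `log_cast_prod_zpow` (the linear
form IS the logarithm of the rational number `∏ aⱼ^{bⱼ}`), `linearForm_ne_zero` (independence ⇒ `Λ ≠ 0`),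
`linearForm_eq_of_pow_eq` / `log_abs_sub_log_abs_le_of_pow_eq` ((2.10): `Λ′ = m₀Λ`),
`stepArch_of_pow_eq` (the step from the algebraic relation, `D := log|m₀|`), `one_le_bound` /
`log_exp_one_mul_nonneg` (`b ≠ 0 ⇒ 1 ≤ B`, `0 ≤ log(eB)`), `coreArch_mono` (monotonicity in `C`), and
`archCoreRat_of_core`: the crux text VERBATIM from `∀ r, CoreArch C r` for one admissible `0 ≤ C r ≤ c₁ʳ`.

WHAT THIS IS NOT: no analytic content (no Liouville inequality, no Minkowski step — those are the sequel
files of parcel P-A1); no crux moves; the cost inequality is the record's.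

References: Yu. V. Nesterenko, *Linear forms in logarithms of rational numbers*, in: Diophantine
Approximation (Cetraro 2000), LNM 1819 (2003), Thm 2.2, Prop. 2.6, (2.9)–(2.13) (pp. 94–96);
E. M. Matveev, Izv. Math. 64 (2000), Thm 2.1/Cor 2.3 (the induction scheme).
-/

noncomputable section

open Finset

namespace Summit.ABC.StewartYu.GenThreeInductionArch

/-! ### The rank-indexed internal statement and the step data (archimedean place) -/

/-- **The internal induction statement of the archimedean Gen-3 engine at rank `r`**: for positive rationals
`aᵢ`, multiplicatively independent, weights `h(aᵢ) ≤ Aᵢ`, `1 ≤ Aᵢ`, exponents `b ≠ 0` with `|bᵢ| ≤ B`: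
`−C(r)·∏ Aᵢ·log(eB) ≤ log |∑ bᵢ log aᵢ|` — the body of the crux text `ArchCoreRat` at the constant function
`C`. [cite: Nesterenko2003, Thm 2.2 (p. 94); shape only] -/
def CoreArch (C : ℕ → ℝ) (r : ℕ) : Prop :=
  ∀ (a : Fin r → ℚ) (b : Fin r → ℤ) (A : Fin r → ℝ) (B : ℝ),
    (∀ i, 0 < a i) →
    (∀ μ : Fin r → ℤ, ∏ i, a i ^ μ i = 1 → μ = 0) →
    (∀ i, Height.logHeight₁ (a i) ≤ A i) → (∀ i, 1 ≤ A i) →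
    b ≠ 0 → (∀ i, (|b i| : ℝ) ≤ B) →
    -(C r * (∏ i, A i) * Real.log (Real.exp 1 * B)) ≤
      Real.log |∑ i, (b i : ℝ) * Real.log (a i : ℝ)|

/-- **The data of one Matveev step at rank `n`, archimedean place** (second branch of the dichotomy): a rank
`r < n`, new positive rational generators `θᵢ`, exponents `m ≠ 0`, weights `A′`, a bound `B′` and an index
cost `D`, satisfying every hypothesis of `CoreArch C r`, the comparison of linear forms
`log |∑ mᵢ log θᵢ| − D ≤ log |∑ bⱼ log aⱼ|` (print: `Λ′ = m₀Λ`, `D = log|m₀|`, (2.10)) and the cost inequality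
`C(r)·∏A′·log(eB′) + D ≤ C(n)·∏A·log(eB)` (last display of the proof of Prop. 2.6).
[cite: Nesterenko2003, Prop 2.6 (2.9)–(2.13) (pp. 95–96)] -/
def StepArch (C : ℕ → ℝ) (n : ℕ) (a : Fin n → ℚ) (b : Fin n → ℤ) (A : Fin n → ℝ) (B : ℝ) : Prop :=
  ∃ (r : ℕ) (θ : Fin r → ℚ) (m : Fin r → ℤ) (A' : Fin r → ℝ) (B' D : ℝ), r < n ∧
    (∀ i, 0 < θ i) ∧
    (∀ μ : Fin r → ℤ, ∏ i, θ i ^ μ i = 1 → μ = 0) ∧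
    (∀ i, Height.logHeight₁ (θ i) ≤ A' i) ∧ (∀ i, 1 ≤ A' i) ∧
    m ≠ 0 ∧ (∀ i, (|m i| : ℝ) ≤ B') ∧
    Real.log |∑ i, (m i : ℝ) * Real.log (θ i : ℝ)| - D ≤
      Real.log |∑ j, (b j : ℝ) * Real.log (a j : ℝ)| ∧
    C r * (∏ i, A' i) * Real.log (Real.exp 1 * B') + D ≤
      C n * (∏ j, A j) * Real.log (Real.exp 1 * B)

/-- **The per-rank dichotomy at the archimedean place** the analytic frame delivers at rank `n`: for every
rank-`n` datum of `CoreArch`, the bound holds or a Matveev step exists. [cite: Nesterenko2003, Prop 2.6] -/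
def DichotomyArch (C : ℕ → ℝ) (n : ℕ) : Prop :=
  ∀ (a : Fin n → ℚ) (b : Fin n → ℤ) (A : Fin n → ℝ) (B : ℝ),
    (∀ j, 0 < a j) →
    (∀ μ : Fin n → ℤ, ∏ j, a j ^ μ j = 1 → μ = 0) →
    (∀ j, Height.logHeight₁ (a j) ≤ A j) → (∀ j, 1 ≤ A j) →
    b ≠ 0 → (∀ j, (|b j| : ℝ) ≤ B) →
    -(C n * (∏ j, A j) * Real.log (Real.exp 1 * B)) ≤
        Real.log |∑ j, (b j : ℝ) * Real.log (a j : ℝ)| ∨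
      StepArch C n a b A B

/-! ### The induction -/

/-- **Matveev's induction on the number of logarithms, archimedean place**: the per-rank dichotomy for every
rank gives the internal statement for every rank (strong induction; the step closes by the induction
hypothesis at the smaller rank, the comparison of linear forms and the cost inequality).
[cite: Nesterenko2003, Thm 2.2 from Prop 2.6 (pp. 94–96)] -/
theorem core_of_dichotomy {C : ℕ → ℝ} (hD : ∀ n, DichotomyArch C n) : ∀ r, CoreArch C r := by
  intro r
  induction r using Nat.strong_induction_on with
  | _ n ih =>
    intro a b A B ha hind hA hA1 hb hB
    rcases hD n a b A B ha hind hA hA1 hb hB with hle | hstep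
    · exact hle
    · obtain ⟨r, θ, m, A', B', D, hr, hθ, hindθ, hA', hA1', hm, hB', hcmp, hcost⟩ := hstep
      have hIH := ih r hr θ m A' B' hθ hindθ hA' hA1' hm hB'
      linarith

/-- The frame's working form of the dichotomy at the archimedean place: ASSUME the negated bound
(`log |Λ| < −C(n)·∏A·log(eB)`, print's (2.14)) and produce the step. [cite: Nesterenko2003, (2.14) p. 96] -/
theorem dichotomyArch_of_not_le {C : ℕ → ℝ} {n : ℕ}
    (h : ∀ (a : Fin n → ℚ) (b : Fin n → ℤ) (A : Fin n → ℝ) (B : ℝ),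
      (∀ j, 0 < a j) →
      (∀ μ : Fin n → ℤ, ∏ j, a j ^ μ j = 1 → μ = 0) →
      (∀ j, Height.logHeight₁ (a j) ≤ A j) → (∀ j, 1 ≤ A j) →
      b ≠ 0 → (∀ j, (|b j| : ℝ) ≤ B) →
      ¬ -(C n * (∏ j, A j) * Real.log (Real.exp 1 * B)) ≤
          Real.log |∑ j, (b j : ℝ) * Real.log (a j : ℝ)| →
      StepArch C n a b A B) :
    DichotomyArch C n := by
  intro a b A B ha hind hA hA1 hb hB
  by_cases hle : -(C n * (∏ j, A j) * Real.log (Real.exp 1 * B)) ≤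
      Real.log |∑ j, (b j : ℝ) * Real.log (a j : ℝ)|
  · exact Or.inl hle
  · exact Or.inr (h a b A B ha hind hA hA1 hb hB hle)

/-! ### The linear form is the logarithm of the rational number `∏ aⱼ^{bⱼ}` -/

/-- Cast of a product of integer powers of rationals to `ℝ`. [folklore] -/
theorem cast_prod_zpow {n : ℕ} (a : Fin n → ℚ) (z : Fin n → ℤ) :
    (((∏ j, a j ^ z j : ℚ)) : ℝ) = ∏ j, ((a j : ℝ)) ^ z j := by
  push_cast
  rfl

/-- A product of integer powers of positive rationals is positive. [folklore] -/
theorem prod_zpow_pos {n : ℕ} (a : Fin n → ℚ) (ha : ∀ j, 0 < a j) (z : Fin n → ℤ) :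
    0 < ∏ j, a j ^ z j :=
  Finset.prod_pos fun j _ => zpow_pos (ha j) _

/-- **`∑ zⱼ log aⱼ = log ∏ aⱼ^{zⱼ}`** for positive rationals `aⱼ` (real logarithms).
[cite: Nesterenko2003, (2.9)–(2.10) p. 95] -/
theorem log_cast_prod_zpow {n : ℕ} (a : Fin n → ℚ) (ha : ∀ j, 0 < a j) (z : Fin n → ℤ) :
    Real.log (((∏ j, a j ^ z j : ℚ)) : ℝ) = ∑ j, (z j : ℝ) * Real.log (a j : ℝ) := by
  rw [cast_prod_zpow, Real.log_prod fun j _ => zpow_ne_zero _ (by exact_mod_cast (ha j).ne')]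
  exact Finset.sum_congr rfl fun j _ => Real.log_zpow _ _

/-- **Independence makes the linear form nonzero**: for positive, multiplicatively independent rationals
`aⱼ` and `b ≠ 0`, `∑ bⱼ log aⱼ ≠ 0`. [cite: Nesterenko2003, Thm 2.2 hypothesis (p. 94)] -/
theorem linearForm_ne_zero {n : ℕ} (a : Fin n → ℚ) (ha : ∀ j, 0 < a j)
    (hind : ∀ μ : Fin n → ℤ, ∏ j, a j ^ μ j = 1 → μ = 0) (b : Fin n → ℤ) (hb : b ≠ 0) :
    ∑ j, (b j : ℝ) * Real.log (a j : ℝ) ≠ 0 := by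
  intro h0
  apply hb
  apply hind b
  have hpos : (0 : ℝ) < (((∏ j, a j ^ b j : ℚ)) : ℝ) := by exact_mod_cast prod_zpow_pos a ha b
  have hlog : Real.log (((∏ j, a j ^ b j : ℚ)) : ℝ) = 0 := by rw [log_cast_prod_zpow a ha b, h0]
  have h1 : (((∏ j, a j ^ b j : ℚ)) : ℝ) = 1 :=
    Real.eq_one_of_pos_of_log_eq_zero hpos hlog
  exact_mod_cast h1

/-- **(2.10): the relation `∏ θᵢ^{mᵢ} = (∏ aⱼ^{bⱼ})^{m₀}` makes the new linear form `m₀` times the old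
one**: `∑ mᵢ log θᵢ = m₀ · ∑ bⱼ log aⱼ`. [cite: Nesterenko2003, Prop 2.6 (2.9)–(2.10) p. 95] -/
theorem linearForm_eq_of_pow_eq {n r : ℕ} (a : Fin n → ℚ) (ha : ∀ j, 0 < a j) (b : Fin n → ℤ)
    (θ : Fin r → ℚ) (hθ : ∀ i, 0 < θ i) (m : Fin r → ℤ) (m₀ : ℤ)
    (hrel : ∏ i, θ i ^ m i = (∏ j, a j ^ b j) ^ m₀) :
    ∑ i, (m i : ℝ) * Real.log (θ i : ℝ) = (m₀ : ℝ) * ∑ j, (b j : ℝ) * Real.log (a j : ℝ) := by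
  rw [← log_cast_prod_zpow θ hθ m, ← log_cast_prod_zpow a ha b, hrel]
  push_cast
  rw [Real.log_zpow]

/-- **The comparison of linear forms of a Matveev step**: under the relation
`∏ θᵢ^{mᵢ} = (∏ aⱼ^{bⱼ})^{m₀}` with `m₀ ≠ 0`, `log |∑ mᵢ log θᵢ| − log|m₀| ≤ log |∑ bⱼ log aⱼ|` (in fact
equality when the old form is nonzero). [cite: Nesterenko2003, Prop 2.6 (2.10) p. 95–96] -/
theorem log_abs_sub_log_abs_le_of_pow_eq {n r : ℕ} (a : Fin n → ℚ) (ha : ∀ j, 0 < a j) (b : Fin n → ℤ)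
    (θ : Fin r → ℚ) (hθ : ∀ i, 0 < θ i) (m : Fin r → ℤ) (m₀ : ℤ) (hm₀ : m₀ ≠ 0)
    (hrel : ∏ i, θ i ^ m i = (∏ j, a j ^ b j) ^ m₀) :
    Real.log |∑ i, (m i : ℝ) * Real.log (θ i : ℝ)| - Real.log |(m₀ : ℝ)| ≤
      Real.log |∑ j, (b j : ℝ) * Real.log (a j : ℝ)| := by
  rw [linearForm_eq_of_pow_eq a ha b θ hθ m m₀ hrel, abs_mul]
  by_cases hΛ : ∑ j, (b j : ℝ) * Real.log (a j : ℝ) = 0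
  · rw [hΛ]
    simp only [abs_zero, mul_zero, Real.log_zero, zero_sub, Left.neg_nonpos_iff]
    exact Real.log_nonneg (by exact_mod_cast Int.one_le_abs hm₀)
  · have hm₀' : |(m₀ : ℝ)| ≠ 0 := abs_ne_zero.mpr (by exact_mod_cast hm₀)
    rw [Real.log_mul hm₀' (abs_ne_zero.mpr hΛ)]
    linarith

/-- For multiplicatively independent positive `aⱼ`, `b ≠ 0`, `m₀ ≠ 0` and the relation
`∏ θᵢ^{mᵢ} = (∏ aⱼ^{bⱼ})^{m₀}`: the new exponent vector `m` is nonzero. [folklore] -/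
theorem ne_zero_of_pow_eq {n r : ℕ} (a : Fin n → ℚ)
    (hind : ∀ μ : Fin n → ℤ, ∏ j, a j ^ μ j = 1 → μ = 0) (b : Fin n → ℤ) (hb : b ≠ 0)
    (θ : Fin r → ℚ) (m : Fin r → ℤ) (m₀ : ℤ) (hm₀ : m₀ ≠ 0)
    (hrel : ∏ i, θ i ^ m i = (∏ j, a j ^ b j) ^ m₀) : m ≠ 0 := by
  intro hm0
  apply GenThreeInductionOdd.zpow_prod_zpow_ne_one a hind b hb m₀ hm₀
  rw [← hrel, hm0]
  simp

/-- **The step from the algebraic relation, archimedean place**: rank-`r` data (`r < n`) satisfying the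
hypotheses of `CoreArch C r`, the relation `∏ θᵐ = (∏ aᵇ)^{m₀}` (`m₀ ≠ 0`) and the cost inequality with the
index cost `log|m₀|` give `StepArch`.  This is the form in which the frame's END (zero estimate ∘ exits ∘
lattice lever, `θᵢ = ∏ aⱼ^{Zᵢⱼ}`, `m₀ b = ∑ mᵢ Zᵢ`) produces it. [cite: Nesterenko2003, Prop 2.6 (2.9)–(2.13)] -/
theorem stepArch_of_pow_eq {C : ℕ → ℝ} {n : ℕ} {a : Fin n → ℚ} {b : Fin n → ℤ} {A : Fin n → ℝ} {B : ℝ}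
    (ha : ∀ j, 0 < a j) (hind : ∀ μ : Fin n → ℤ, ∏ j, a j ^ μ j = 1 → μ = 0) (hb : b ≠ 0)
    {r : ℕ} (hr : r < n) (θ : Fin r → ℚ) (m : Fin r → ℤ) (A' : Fin r → ℝ) (B' : ℝ)
    (hθ : ∀ i, 0 < θ i) (hindθ : ∀ μ : Fin r → ℤ, ∏ i, θ i ^ μ i = 1 → μ = 0)
    (hA' : ∀ i, Height.logHeight₁ (θ i) ≤ A' i) (hA1' : ∀ i, 1 ≤ A' i) (hB' : ∀ i, (|m i| : ℝ) ≤ B')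
    (m₀ : ℤ) (hm₀ : m₀ ≠ 0) (hrel : ∏ i, θ i ^ m i = (∏ j, a j ^ b j) ^ m₀)
    (hcost : C r * (∏ i, A' i) * Real.log (Real.exp 1 * B') + Real.log |(m₀ : ℝ)| ≤
      C n * (∏ j, A j) * Real.log (Real.exp 1 * B)) :
    StepArch C n a b A B :=
  ⟨r, θ, m, A', B', Real.log |(m₀ : ℝ)|, hr, hθ, hindθ, hA', hA1',
    ne_zero_of_pow_eq a hind b hb θ m m₀ hm₀ hrel, hB',
    log_abs_sub_log_abs_le_of_pow_eq a ha b θ hθ m m₀ hm₀ hrel, hcost⟩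

/-! ### Elementary facts about the bound `B` and monotonicity in `C` -/

/-- `b ≠ 0` and `|bᵢ| ≤ B` force `1 ≤ B`. [folklore] -/
theorem one_le_bound {n : ℕ} {b : Fin n → ℤ} (hb : b ≠ 0) {B : ℝ} (hB : ∀ i, (|b i| : ℝ) ≤ B) :
    1 ≤ B := by
  obtain ⟨i, hi⟩ : ∃ i, b i ≠ 0 := by
    by_contra h
    push Not at h
    exact hb (funext h)
  exact le_trans (by exact_mod_cast Int.one_le_abs hi) (hB i)

/-- `1 ≤ B ⇒ 1 ≤ log(eB)` (so the right-hand side `C·Ω·log(eB)` is at least `C·Ω`). [folklore] -/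
theorem one_le_log_exp_one_mul {B : ℝ} (hB : 1 ≤ B) : 1 ≤ Real.log (Real.exp 1 * B) := by
  rw [Real.log_mul (Real.exp_pos 1).ne' (by linarith), Real.log_exp]
  linarith [Real.log_nonneg hB]

/-- `b ≠ 0`, `|bᵢ| ≤ B ⇒ 0 ≤ log(eB)`. [folklore] -/
theorem log_exp_one_mul_nonneg {n : ℕ} {b : Fin n → ℤ} (hb : b ≠ 0) {B : ℝ}
    (hB : ∀ i, (|b i| : ℝ) ≤ B) : 0 ≤ Real.log (Real.exp 1 * B) :=
  zero_le_one.trans (one_le_log_exp_one_mul (one_le_bound hb hB))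

/-- `1 ≤ Aᵢ` for all `i` gives `0 ≤ ∏ Aᵢ` (indeed `1 ≤ ∏ Aᵢ`). [folklore] -/
theorem one_le_prod_weights {n : ℕ} {A : Fin n → ℝ} (hA1 : ∀ i, 1 ≤ A i) : 1 ≤ ∏ i, A i :=
  Finset.one_le_prod fun i _ => hA1 i

/-- **Monotonicity of the internal statement in the constant**: `C r ≤ C′ r ⇒ CoreArch C r → CoreArch C′ r`.
[folklore] -/
theorem coreArch_mono {C C' : ℕ → ℝ} {r : ℕ} (hCC' : C r ≤ C' r) (h : CoreArch C r) : CoreArch C' r := by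
  intro a b A B ha hind hA hA1 hb hB
  have hcore := h a b A B ha hind hA hA1 hb hB
  have hprod : 0 ≤ ∏ i, A i := zero_le_one.trans (one_le_prod_weights hA1)
  have hlog : 0 ≤ Real.log (Real.exp 1 * B) := log_exp_one_mul_nonneg hb hB
  have hle : C r * (∏ i, A i) * Real.log (Real.exp 1 * B) ≤
      C' r * (∏ i, A i) * Real.log (Real.exp 1 * B) :=
    mul_le_mul_of_nonneg_right (mul_le_mul_of_nonneg_right hCC' hprod) hlog
  linarith

/-! ### The crux text `ArchCoreRat` from the core -/

/-- **The route's crux text `ArchCoreRat` (HOME/plan/routeGA-v2/SketchGA.v2.lean; = hypothesis `h₁` of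
`Summit.ABC.StewartYu.approximationBound_of_shapeCores` and of
`Literature…Dioph.approximationBound_rat_of_cores`) VERBATIM from the internal statement at every rank**, for
one admissible `0 ≤ C r ≤ c₁ʳ`. [cite: Nesterenko2003, Thm 2.2 (p. 94); shape only] -/
theorem archCoreRat_of_core {C : ℕ → ℝ} {c₁ : ℝ} (hC : ∀ r, 0 ≤ C r ∧ C r ≤ c₁ ^ r)
    (hcore : ∀ r, CoreArch C r) :
    ∃ c : ℝ, ∀ (r : ℕ) (a : Fin r → ℚ) (b : Fin r → ℤ) (A : Fin r → ℝ) (B : ℝ),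
      (∀ i, 0 < a i) →
      (∀ μ : Fin r → ℤ, ∏ i, a i ^ μ i = 1 → μ = 0) →
      (∀ i, Height.logHeight₁ (a i) ≤ A i) → (∀ i, 1 ≤ A i) →
      b ≠ 0 → (∀ i, (|b i| : ℝ) ≤ B) →
      -(c ^ r * (∏ i, A i) * Real.log (Real.exp 1 * B)) ≤
        Real.log |∑ i, (b i : ℝ) * Real.log (a i : ℝ)| :=
  ⟨c₁, fun r => coreArch_mono (C' := fun r => c₁ ^ r) (hC r).2 (hcore r)⟩

end Summit.ABC.StewartYu.GenThreeInductionArch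

end
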